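import Literature.AnabelianGeometry.SemiGraphs.TemperedFixedLocusBaseImages
import Mathlib.Data.Set.Card
import HarnessLib

/-!
# [SemiAnbd] Thm 3.7 (iii) beyond finite `𝔾`: the compatible fixed system from EVENTUALLY FINITE IMAGES of the fixed loci

Mochizuki, *Semi-graphs of anabelioids*, Publ. RIMS **42** (2006), §3, Theorem 3.7 (iii), manuscript
p. 41 ("we may assume that there exists a compatible system of vertices of `𝒢_{∞,j}`, for `j ∈ J`, each
of which is fixed by `H`"; Comments (2020) (6)(b): "each of the nonempty sets `E_{j,i}`, for `i`
sufficiently large relative to `j`, is of cardinality 1 … this implies that each intersection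
`E_{j,∞} := ⋂_{i ≥ j} E_{j,i}` is of cardinality 1") [cite: MochizukiSemiAnbd2006, Thm 3.7(iii) p.41].

PROOF-ONLY (cell abc-iut, layer L3, GAP row G-t6g3-2b, sub-row G2·E1-V / E1-V-tor; seat
abc-iut-w6-d066; no definition, no new named fact).  abc-iut-w4-d080's Kőnig step
(`VerticialLevelData.hfix_of_finite_fixed_over`, `TemperedFixedSystemOfFiniteFibres.lean`) asks the
`C`-fixed tree vertices over a persistent base vertex to be FINITE at every level — which fails in the
«torsor / drift» regime (a compact `C` centralising a nontrivial deck transformation fixes a bi-infinite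
geodesic at that level).  Print's own mechanism is weaker and survives that regime: what must be small is
not the fixed locus `V_i` of a level but its IMAGE `V_{j,i}` at a FIXED lower level `j` for `i ≫ j`.  This
file isolates exactly that:

* `VerticialLevelData.fixedLocus_image_antitone` — the images at level `j` of the `C`-fixed loci of the
  levels `k ≥ j` DECREASE with `k`;
* `VerticialLevelData.hfix_of_eventually_finite_images` — if for every level `j` the image at `j` of the
  `C`-fixed locus of SOME level `k ≥ j` is finite (hence of all higher ones), then a compact `C` fixes a
  compatible system of tree vertices (`hfix` of (FIX∞)): the images from high levels form, inside that
  finite set, a directed decreasing family of nonempty finite sets, so they stabilise; the stable image is a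
  nonempty finite trans-stable family of `C`-fixed vertices, and abc-iut-w4-d080's
  `hfix_of_finite_fixed_family` (Kőnig over the directed levels) applies.

Desk input it is meant to serve (memo `THM37iii-LOCFIN-PERSISTENCE.md` of this seat, NOT claimed in
kernel): at a LOCALLY FINITE `𝔾` with a persistent base vertex the images `V_{j,k}`, `k ≫ j`, lie inside
ONE closed edge of `𝒢_{∞,j}` (print's subjoint/estrangement argument localised), so the hypothesis below
holds there.  At abc-iut-w4-d075's `𝒢⋆` the hypothesis fails at the centre (infinite images) although
`hfix` holds — nothing false is asserted.  Nothing here bears on [IUTchIII] Cor. 3.12.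
-/

namespace Literature.AnabelianGeometry.SemiGraphs

namespace ProfiniteSemiGraph

namespace VerticialLevelData

open CategoryTheory Topology

universe v u

variable {𝒢 : ProfiniteSemiGraph.{u}} {c : TemperedPiChart 𝒢} (D : VerticialLevelData.{v} 𝒢 c)

/-- **The level-`j` images of the fixed loci decrease along the tower** ("`E_{j,i₁} ⊆ E_{j,i₂} ⊆ E_j`
for `i₁ ≥ i₂`", Comments (2020) (6)): for `j ≤ k ≤ k'` the image under `trans : 𝒢_{∞,k'} → 𝒢_{∞,j}` of
the `C`-fixed vertices of level `k'` lies in the image of the `C`-fixed vertices of level `k` (the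
transition `𝒢_{∞,k'} → 𝒢_{∞,k}` is equivariant and the transitions compose).
[cite: MochizukiSemiAnbd2006, Thm 3.7(iii) p.41] -/
theorem fixedLocus_image_antitone (C : Subgroup c.G) ⦃j k k' : D.J⦄ (hjk : j ≤ k) (hkk' : k ≤ k') :
    (D.trans (hjk.trans hkk')).vertexMap ''
        {x : (D.tree k').Vertex | ∀ g ∈ C, (D.act k' g).hom.vertexMap x = x} ⊆
      (D.trans hjk).vertexMap '' {x : (D.tree k).Vertex | ∀ g ∈ C, (D.act k g).hom.vertexMap x = x} := by
  rintro _ ⟨x, hx, rfl⟩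
  refine ⟨(D.trans hkk').vertexMap x, fun g hg => ?_, ?_⟩
  · rw [← D.trans_act_vertexMap hkk' g x, hx g hg]
  · rw [D.trans_vertexMap_comp hjk hkk' x]

/-- **`hfix` from eventually finite images** (print p. 41 / Comments (2020) (6)(b), the compatibility
step in the form that survives infinite fixed loci): let `C` be a compact subgroup of `π₁^temp(𝒢)` such
that for every level `j` there is a level `k ≥ j` whose `C`-fixed locus has FINITE image in `𝒢_{∞,j}`.
Then `C` fixes a compatible system of vertices of the trees `𝒢_{∞,j}` — the clause `hfix` of (FIX∞).
Proof: at each `j` the images from the levels above such a `k` form a directed decreasing family of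
nonempty (`fixedLocus_nonempty`) finite sets, hence one of minimal cardinality is contained in all of
them; these stable images are `C`-fixed, finite, nonempty and mapped into each other by the transition
maps, so abc-iut-w4-d080's Kőnig step `hfix_of_finite_fixed_family` yields the compatible system.
[cite: MochizukiSemiAnbd2006, Thm 3.7(iii) p.41] -/
theorem hfix_of_eventually_finite_images (C : Subgroup c.G) (hC : IsCompact (C : Set c.G))
    (hfin : ∀ j : D.J, ∃ (k : D.J) (h : j ≤ k),
      ((D.trans h).vertexMap '' {x : (D.tree k).Vertex | ∀ g ∈ C, (D.act k g).hom.vertexMap x = x}).Finite) :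
    ∃ x : ∀ j, (D.tree j).Vertex, (∀ ⦃i j : D.J⦄ (h : i ≤ j), (D.trans h).vertexMap (x j) = x i) ∧
      ∀ g ∈ C, ∀ j, (D.act j g).hom.vertexMap (x j) = x j := by
  classical
  -- the `C`-fixed locus of level `k` and its image at a level `j ≤ k`
  let Fix : ∀ k : D.J, Set (D.tree k).Vertex :=
    fun k => {x : (D.tree k).Vertex | ∀ g ∈ C, (D.act k g).hom.vertexMap x = x}
  let img : ∀ ⦃j k : D.J⦄, j ≤ k → Set (D.tree j).Vertex :=
    fun j k h => (D.trans h).vertexMap '' Fix k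
  have img_anti : ∀ ⦃j k k' : D.J⦄ (hjk : j ≤ k) (hkk' : k ≤ k'),
      img (hjk.trans hkk') ⊆ img hjk :=
    fun j k k' hjk hkk' => D.fixedLocus_image_antitone C hjk hkk'
  have img_ne : ∀ ⦃j k : D.J⦄ (h : j ≤ k), (img h).Nonempty := fun j k h => by
    obtain ⟨x, hx⟩ := D.fixedLocus_nonempty C hC k
    exact ⟨_, x, hx, rfl⟩
  -- at each level `j`, a level `k₁ j ≥ j` whose image is contained in every image
  have hstab : ∀ j : D.J, ∃ (k₁ : D.J) (h₁ : j ≤ k₁), (img h₁).Finite ∧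
      ∀ (k : D.J) (h : j ≤ k), img h₁ ⊆ img h := by
    intro j
    obtain ⟨k₀, h₀, hfin₀⟩ := hfin j
    -- cardinalities of the (finite) images from the levels above `k₀`
    have hP : ∃ n : ℕ, ∃ (k : D.J) (hk : k₀ ≤ k), (img (h₀.trans hk)).ncard = n :=
      ⟨_, k₀, le_refl _, rfl⟩
    let n := Nat.find hP
    obtain ⟨k₁, hk₁, hn⟩ : ∃ (k : D.J) (hk : k₀ ≤ k), (img (h₀.trans hk)).ncard = n := Nat.find_spec hP
    have hfin₁ : (img (h₀.trans hk₁)).Finite := hfin₀.subset (img_anti h₀ hk₁)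
    refine ⟨k₁, h₀.trans hk₁, hfin₁, fun k h => ?_⟩
    obtain ⟨k', hkk', hk₁k'⟩ := exists_ge_ge k k₁
    -- the image from `k'` sits inside the image from `k₁`, is finite, and has no smaller cardinality
    have hsub : img (h₀.trans (hk₁.trans hk₁k')) ⊆ img (h₀.trans hk₁) := img_anti (h₀.trans hk₁) hk₁k'
    have hle : n ≤ (img (h₀.trans (hk₁.trans hk₁k'))).ncard :=
      Nat.find_min' hP ⟨k', hk₁.trans hk₁k', rfl⟩
    have heq : img (h₀.trans (hk₁.trans hk₁k')) = img (h₀.trans hk₁) :=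
      Set.eq_of_subset_of_ncard_le hsub (hn ▸ hle) hfin₁
    -- hence the image from `k₁` equals the image from `k'`, which lies in the image from `k`
    have e₁ : (h₀.trans (hk₁.trans hk₁k') : j ≤ k') = (h.trans hkk' : j ≤ k') := rfl
    rw [← heq, e₁]
    exact img_anti h hkk'
  -- the stable images: a nonempty finite trans-stable family of `C`-fixed vertices
  choose k₁ h₁ hfin₁ hmin using hstab
  refine D.hfix_of_finite_fixed_family C (fun j => img (h₁ j)) ?_ ?_ ?_ ?_
  · -- `C`-fixed: images of fixed vertices are fixed (equivariance)
    rintro j _ ⟨x, hx, rfl⟩ g hg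
    rw [← D.trans_act_vertexMap (h₁ j) g x, hx g hg]
  · exact fun j => img_ne (h₁ j)
  · exact fun j => hfin₁ j
  · -- trans-stable: `trans_{ij}` maps the stable image at `j` into every image at `i`, in particular
    -- into the stable one
    rintro i j hij _ ⟨x, hx, rfl⟩
    have hmem : (D.trans hij).vertexMap ((D.trans (h₁ j)).vertexMap x) ∈ img (hij.trans (h₁ j)) := by
      rw [D.trans_vertexMap_comp hij (h₁ j) x]
      exact ⟨x, hx, rfl⟩
    obtain ⟨k', hk', hk₁'⟩ := exists_ge_ge (k₁ j) (k₁ i)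
    -- `img_i(k₁ j) ⊇`? no: use minimality at `i`: `img (h₁ i) ⊆ img (hij.trans (h₁ j))` is the wrong way;
    -- instead push the point up to `k'` is impossible, so argue via minimality: the stable image at `i` is
    -- contained in `img_i(k₁ j)`, and we need membership of our point in the stable image at `i`.
    -- Minimality gives `img (h₁ i) ⊆ img (hij.trans (h₁ j))`; for the converse inclusion needed here we
    -- use that the stable image at `j` is itself the image from ANY higher level `k'`.
    have hxj : (D.trans (h₁ j)).vertexMap x ∈ img ((h₁ j).trans hk') := by
      -- `img (h₁ j) ⊆ img ((h₁ j).trans hk')` by minimality at `j`, and our point lies in `img (h₁ j)`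
      exact hmin j k' ((h₁ j).trans hk') ⟨x, hx, rfl⟩
    obtain ⟨y, hy, hyx⟩ := hxj
    -- now `trans_{ij} (trans_{j k'} y) = trans_{i k'} y = trans_{i, k₁ i} (trans_{k₁ i, k'} y)`
    refine ⟨(D.trans hk₁').vertexMap y, fun g hg => ?_, ?_⟩
    · rw [← D.trans_act_vertexMap hk₁' g y, hy g hg]
    · rw [D.trans_vertexMap_comp (h₁ i) hk₁' y, ← hyx, D.trans_vertexMap_comp hij ((h₁ j).trans hk') y]

end VerticialLevelData

end ProfiniteSemiGraph

end Literature.AnabelianGeometry.SemiGraphs
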